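import Literature.NumberTheory.EllipticCurves.IwasawaAlgebraDivisibilityProofs
import Literature.NumberTheory.EllipticCurves.FunctionFieldBSDTateLemmaZ3Proofs
import Mathlib.Algebra.Module.CharacterModule
import HarnessLib

/-!
# One localisation step for characteristic ideals of Pontryagin duals:
# `0 → A → B → L` exact ⟹ `Ch(A^∨) · (P) ⊆ Ch(B^∨)` for every `P ∈ Ch(L^∨)`, and `B^∨` is torsion

Generic commutative algebra (THEOREMS ONLY; no definition, no named fact, no `sorry`), the algebraic
half of the `Σ`-change of characteristic ideals of Selmer duals ([JetchevSkinnerWan2017] proof of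
Thm. 6.1.6; [Skinner2016PacificMC] §2.3 p. 180 "`Ch^{Σ₂}_L(f) ⊇ Ch^{Σ₁}_L(f) · ∏_{ℓ∈Σ₂∖Σ₁} (P_ℓ(…))`";
[GreenbergVatsal2000] §2): if `Sel^{Σ₁} = A ↪ B = Sel^{Σ₂}` with `B/A ↪ L` (the local cohomology at
the ONE extra place, NO surjectivity of localisation asked), then, dualising (`ℚ/ℤ` is injective:
`B^∨ ↠ A^∨` with kernel `(B/A)^∨`, a quotient of `L^∨`), the characteristic ideal is multiplicative on
`0 → (B/A)^∨ → B^∨ → A^∨ → 0` and `Ch(L^∨) ⊆ Ch((B/A)^∨)`; hence `Ch(A^∨)·(P) ⊆ Ch(B^∨)` for every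
`P ∈ Ch(L^∨)`, and `B^∨` is torsion as an extension of torsion modules. Over a Noetherian domain `R`
(`Λ = ℤ_p⟦T⟧`), with `Literature.NumberTheory.EllipticCurves.Module.charIdeal` and Mathlib's
`CharacterModule` (`Hom(·, ℚ/ℤ)` with `(r·χ)(x) = χ(r·x)`).

* **`Module.isTorsion_and_charIdeal_mul_span_le_of_exact_dual`** — the step (torsion of `B^∨` by the
  tree's `Module.isTorsion_of_exact` ∕ `isTorsion_of_surjective`).

Cell `bsd-stepL` (K2 support 20338 ∕ 20427), seat `bsd-stepL-imc-p1` (prover g12, 2026-08-27).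
References: [JetchevSkinnerWan2017] proof of Thm. 6.1.6; [Skinner2016PacificMC] §2.3 (p. 180);
[GreenbergVatsal2000] §2 (Prop. 2.4 and the surrounding exact sequences); Bourbaki AC VII §4.5 Prop. 10
(multiplicativity, the tree's `Module.charIdeal_eq_mul_of_exact`); [Tate1966Bourbaki] §5 Lemma z.3
(exactness of `Hom(·, ℚ/ℤ)`, the tree's `TateBourbaki.exact_dual_mkQ_dual`).
-/

namespace Literature.NumberTheory.EllipticCurves.Module

open CharacterModule

variable {R : Type*} [CommRing R]
variable {A B L : Type*} [AddCommGroup A] [_root_.Module R A] [AddCommGroup B] [_root_.Module R B]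
  [AddCommGroup L] [_root_.Module R L]

/-- **One localisation step.** Let `R` be a Noetherian domain, `i : A ↪ B` injective and
`r : B → L` with `0 → A → B → L` exact at `B`. Suppose `B^∨` is finitely generated, `A^∨` is torsion,
and `L^∨` is finitely generated torsion with `P ∈ Ch(L^∨)` (all duals are Mathlib `CharacterModule`s,
`Ch` the tree's `Module.charIdeal`). Then `B^∨` is torsion and `Ch(A^∨) · (P) ⊆ Ch(B^∨)`. Proof:
`B^∨ ↠ A^∨` (injectivity of `ℚ/ℤ`) with kernel `(B/i(A))^∨` (Tate's Lemma z.3), itself a quotient of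
`L^∨` along the dual of the injection `B/i(A) ↪ L`; multiplicativity of `Ch` on both short exact
sequences. [cite: Skinner2016PacificMC, §2.3 (p. 180, "`Ch^{Σ₂}_L(f) ⊇ Ch^{Σ₁}_L(f) · ∏ (P_ℓ(…))`")]
[cite: JetchevSkinnerWan2017, proof of Thm. 6.1.6 (arXiv:1512.06894 tex p0026 L82–96)] -/
theorem isTorsion_and_charIdeal_mul_span_le_of_exact_dual [IsNoetherianRing R] [IsDomain R]
    (i : A →ₗ[R] B) (hi : Function.Injective i) (r : B →ₗ[R] L) (hir : Function.Exact i r)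
    [Module.Finite R (CharacterModule B)] (hA : Module.IsTorsion R (CharacterModule A))
    [Module.Finite R (CharacterModule L)] (hL : Module.IsTorsion R (CharacterModule L))
    {P : R} (hP : P ∈ charIdeal R (CharacterModule L)) :
    Module.IsTorsion R (CharacterModule B) ∧
      charIdeal R (CharacterModule A) * Ideal.span {P} ≤ charIdeal R (CharacterModule B) := by
  -- the quotient `Q = B / i(A)` embeds into `L`
  set U : Submodule R B := LinearMap.range i with hU
  have hle : U ≤ LinearMap.ker r := by rw [hU, ← hir.linearMap_ker_eq]
  set rbar : (B ⧸ U) →ₗ[R] L := U.liftQ r hle with hrbar_def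
  have hrbar : Function.Injective rbar := by
    rw [← LinearMap.ker_eq_bot]
    exact Submodule.ker_liftQ_eq_bot _ _ _ (by rw [hU, ← hir.linearMap_ker_eq])
  -- dual maps
  have hf₁ : Function.Injective (dual (R := R) U.mkQ) :=
    dual_injective_of_surjective _ (Submodule.mkQ_surjective U)
  have hg₁ : Function.Surjective (dual i) := dual_surjective_of_injective i hi
  have hex₁ : Function.Exact (dual (R := R) U.mkQ) (dual i) := TateBourbaki.exact_dual_mkQ_dual i
  have hψ : Function.Surjective (dual rbar) := dual_surjective_of_injective rbar hrbar
  -- `Q^∨` is finitely generated torsion, as a quotient of `L^∨`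
  haveI : Module.Finite R (CharacterModule (B ⧸ U)) := Module.Finite.of_surjective (dual rbar) hψ
  have hQ : Module.IsTorsion R (CharacterModule (B ⧸ U)) :=
    Literature.NumberTheory.EllipticCurves.isTorsion_of_surjective _ hψ hL
  -- `B^∨` is torsion
  have hB : Module.IsTorsion R (CharacterModule B) := isTorsion_of_exact _ _ hex₁ hQ hA
  refine ⟨hB, ?_⟩
  -- multiplicativity on `0 → Q^∨ → B^∨ → A^∨ → 0`
  have h1 : charIdeal R (CharacterModule B) =
      charIdeal R (CharacterModule (B ⧸ U)) * charIdeal R (CharacterModule A) :=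
    charIdeal_eq_mul_of_exact hB _ _ hf₁ hg₁ hex₁
  -- multiplicativity on `0 → ker → L^∨ → Q^∨ → 0`
  have h2 : charIdeal R (CharacterModule L) =
      charIdeal R (LinearMap.ker (dual rbar)) * charIdeal R (CharacterModule (B ⧸ U)) :=
    charIdeal_eq_mul_of_exact hL _ _ (Submodule.injective_subtype _) hψ
      (LinearMap.exact_subtype_ker_map _)
  have hPQ : P ∈ charIdeal R (CharacterModule (B ⧸ U)) := by
    have h := hP
    rw [h2] at h
    exact Ideal.mul_le_left h
  rw [h1, mul_comm (charIdeal R (CharacterModule (B ⧸ U)))]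
  exact Ideal.mul_mono_right ((Ideal.span_singleton_le_iff_mem _).mpr hPQ)

end Literature.NumberTheory.EllipticCurves.Module
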